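import Mathlib

/-!
# Stub `stub_packageOfUnitMap` (crux `FemtoCurvatureTwoPointC`, line Sketch, step E-b)

Pure real arithmetic ("IR-anchored telescoping").  A finite-volume coupling `u L β` is given with

* in-window comparability `|u(L,β)⁻¹ - u(L',β)⁻¹| ≤ κ₂` for `L ≤ L' ≤ 2L` (box `L` in the window
  `∀ M ∈ [8, L], u M β ≤ u₀`),
* the two-sided averaged dyadic step law
  `κ₁ m - κ₃ ≤ u(8·2ᵏ,β)⁻¹ - u(8·2ᵏ⁺ᵐ,β)⁻¹ ≤ κ₂ m + κ₃` (box `8·2ᵏ⁺ᵐ` in the window),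
* per-datum axis matching `c·u(8n,β)² ≤ A(L,β,n) ≤ C·u(8n,β)²` on window boxes `L ≥ 8n`,
* a unit map `a` pinned to the window exit: for `β ≥ β₁` exactly the dyadic boxes `8·2ᵏ`, `k < k₀`,
  are in the window and `2^{-D}·8·2^{k₀} ≤ ℓ₀ / a β ≤ 8·2^{k₀-1}`.

We produce the explicit shape `Γ s = (A₁ / (A₁ + κ₂⁺ · max 0 (log₂ (ℓ₀ / (8 s)))))²` and constants
`c', C'` such that `c'·Γ(n·a β) ≤ A(L,β,n) ≤ C'·Γ(n·a β)` for every box `L` with `L · a β ≤ ℓ₀`,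
together with the pair envelope `max C 0 · u(max 8 (min L (8⌈d⌉)),β)² ≤ C'·Γ(d·a β)` for real
`1 ≤ d ≤ L`.

Proof idea: the inverse coupling of a box `N ∈ [8·2ᵏ, 16·2ᵏ]` is compared (one comparability step,
then the dyadic law) with the inverse coupling of the last window box `8·2^{k₀-1}`, which is within
`κ₂` of `u₀⁻¹` by the exit condition; the number `m = k₀ - 1 - k` of octaves in between is
`log₂ (ℓ₀ / (8 n a β)) + O(1)` by the pinning inequalities.  The resulting two affine envelopes
`u₀⁻¹/2 + μ κ₁ T ≤ u(N,β)⁻¹ ≤ A₁ + κ₂⁺ T` have bounded ratio `R`, whence the claim with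
`c' = c / A₁²` and `C' = max C 0 · R² / A₁²`.
-/

set_option autoImplicit false

namespace Summit.QuantumFields.YangMills.Theorems.FemtoCurvatureTwoPointC

/-- Every natural number `N ≥ 8` lies in a dyadic bracket `8·2ᵏ ≤ N < 16·2ᵏ`. -/
theorem exists_dyadic_bracket (N : ℕ) (hN : 8 ≤ N) :
    ∃ k : ℕ, 8 * 2 ^ k ≤ N ∧ N < 16 * 2 ^ k := by
  have h1 : 2 ^ Nat.log 2 N ≤ N := Nat.pow_log_le_self 2 (by omega)
  have h2 : N < 2 ^ (Nat.log 2 N + 1) := Nat.lt_pow_succ_log_self one_lt_two N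
  have hJ : 3 ≤ Nat.log 2 N := by
    by_contra h
    have h3 : 2 ^ (Nat.log 2 N + 1) ≤ 2 ^ 3 := Nat.pow_le_pow_right (by norm_num) (by omega)
    norm_num at h3
    omega
  obtain ⟨k, hk⟩ := Nat.exists_eq_add_of_le hJ
  refine ⟨k, ?_, ?_⟩
  · rw [hk, pow_add] at h1
    norm_num at h1
    omega
  · rw [hk, add_assoc, pow_add] at h2
    norm_num at h2
    rw [pow_succ] at h2
    omega

/-- Upper octave count: if `ℓ₀ / α ≤ 8·2ʲ` and `8·2ʲ ≤ 2ᵖ·(8 t)` then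
`max 0 (log₂ (ℓ₀ / (8 t α))) ≤ p`. -/
theorem max_logb_le (ℓ₀ α t : ℝ) (j p : ℕ) (hℓ₀ : 0 < ℓ₀) (hα : 0 < α) (ht : 0 < t)
    (hpin : ℓ₀ / α ≤ 8 * 2 ^ j) (h : (8 : ℝ) * 2 ^ j ≤ 2 ^ p * (8 * t)) :
    max 0 (Real.logb 2 (ℓ₀ / (8 * (t * α)))) ≤ p := by
  refine max_le (Nat.cast_nonneg p) ?_
  rw [Real.logb_le_iff_le_rpow one_lt_two (by positivity), Real.rpow_natCast,
    div_le_iff₀ (by positivity)]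
  have h1 : ℓ₀ ≤ 8 * 2 ^ j * α := (div_le_iff₀ hα).1 hpin
  calc ℓ₀ ≤ 8 * 2 ^ j * α := h1
    _ ≤ 2 ^ p * (8 * t) * α := mul_le_mul_of_nonneg_right h hα.le
    _ = 2 ^ p * (8 * (t * α)) := by ring

/-- Lower octave count: if `8·2ʲ⁺¹ ≤ 2ᴰ·(ℓ₀ / α)` and `2ᵖ·(8 t) ≤ 8·2ʲ⁺¹` then
`p ≤ max 0 (log₂ (ℓ₀ / (8 t α))) + D`. -/
theorem le_max_logb_add (ℓ₀ α t D : ℝ) (j p : ℕ) (hℓ₀ : 0 < ℓ₀) (hα : 0 < α) (ht : 0 < t)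
    (hpin : (8 : ℝ) * 2 ^ (j + 1) ≤ 2 ^ D * (ℓ₀ / α))
    (h : (2 : ℝ) ^ p * (8 * t) ≤ 8 * 2 ^ (j + 1)) :
    (p : ℝ) ≤ max 0 (Real.logb 2 (ℓ₀ / (8 * (t * α)))) + D := by
  suffices hs : (p : ℝ) - D ≤ Real.logb 2 (ℓ₀ / (8 * (t * α))) by
    linarith [le_max_right 0 (Real.logb 2 (ℓ₀ / (8 * (t * α))))]
  rw [Real.le_logb_iff_rpow_le one_lt_two (by positivity), Real.rpow_sub two_pos,
    Real.rpow_natCast, div_le_div_iff₀ (by positivity) (by positivity)]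
  have h1 : 8 * 2 ^ (j + 1) * α ≤ 2 ^ D * ℓ₀ := by
    rw [mul_div_assoc'] at hpin
    exact (le_div_iff₀ hα).1 hpin
  calc (2 : ℝ) ^ p * (8 * (t * α)) = 2 ^ p * (8 * t) * α := by ring
    _ ≤ 8 * 2 ^ (j + 1) * α := mul_le_mul_of_nonneg_right h hα.le
    _ ≤ 2 ^ D * ℓ₀ := h1
    _ = ℓ₀ * 2 ^ D := mul_comm _ _

/-- The two affine envelopes of the inverse coupling have bounded ratio: from `i₀ ≤ x` and
`i₀ - S + κ₁ T ≤ x` (with `μ S ≤ i₀/2`, `A₁ ≤ R i₀ / 2`, `κ₂⁺ ≤ R μ κ₁`) we get `A₁ + κ₂⁺ T ≤ R x`. -/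
theorem envelope_ratio (x i₀ S κ₁ κ₂p T μ R A₁ : ℝ) (hx1 : i₀ ≤ x) (hx2 : i₀ - S + κ₁ * T ≤ x)
    (hT : 0 ≤ T) (hμ0 : 0 ≤ μ) (hμ1 : μ ≤ 1) (hμS : μ * S ≤ i₀ / 2) (hR : 0 ≤ R)
    (hR1 : A₁ ≤ R * i₀ / 2) (hR2 : κ₂p ≤ R * (μ * κ₁)) : A₁ + κ₂p * T ≤ R * x := by
  have h1 : i₀ / 2 + μ * κ₁ * T ≤ x := by
    nlinarith [mul_le_mul_of_nonneg_left hx2 hμ0,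
      mul_le_mul_of_nonneg_left hx1 (sub_nonneg.2 hμ1)]
  have h2 : R * (i₀ / 2 + μ * κ₁ * T) ≤ R * x := mul_le_mul_of_nonneg_left h1 hR
  have h3 : κ₂p * T ≤ R * (μ * κ₁) * T := mul_le_mul_of_nonneg_right hR2 hT
  nlinarith [h2, h3]

/-- From an upper envelope `v⁻¹ ≤ P` of the inverse to the lower bound
`(c / A₁²)·(A₁ / P)² ≤ c·v²`. -/
theorem sq_lower_of_inv_le (v P c A₁ : ℝ) (hv : 0 < v) (hP : 0 < P) (hA₁ : 0 < A₁)
    (hc : 0 ≤ c) (h : v⁻¹ ≤ P) : c / A₁ ^ 2 * (A₁ / P) ^ 2 ≤ c * v ^ 2 := by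
  have h1 : P⁻¹ ≤ v := inv_le_of_inv_le₀ hv h
  have h2 : c / A₁ ^ 2 * (A₁ / P) ^ 2 = c * P⁻¹ ^ 2 := by
    field_simp
  rw [h2]
  exact mul_le_mul_of_nonneg_left (pow_le_pow_left₀ (inv_nonneg.2 hP.le) h1 2) hc

/-- From a lower envelope `P ≤ R·v⁻¹` of the inverse to the upper bound
`K·v² ≤ (K R² / A₁²)·(A₁ / P)²`. -/
theorem sq_upper_of_le_inv (v P R K A₁ : ℝ) (hv : 0 < v) (hP : 0 < P) (hA₁ : 0 < A₁)
    (hK : 0 ≤ K) (h : P ≤ R * v⁻¹) : K * v ^ 2 ≤ K * R ^ 2 / A₁ ^ 2 * (A₁ / P) ^ 2 := by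
  have h0 : P * v ≤ R := by
    have := mul_le_mul_of_nonneg_right h hv.le
    rwa [mul_assoc, inv_mul_cancel₀ hv.ne', mul_one] at this
  have h1 : v ≤ R / P := by
    rw [le_div_iff₀ hP]
    linarith [mul_comm P v]
  have h2 : K * R ^ 2 / A₁ ^ 2 * (A₁ / P) ^ 2 = K * (R / P) ^ 2 := by
    field_simp
  rw [h2]
  exact mul_le_mul_of_nonneg_left (pow_le_pow_left₀ hv.le h1 2) hK

/-- **Envelope of the inverse coupling of a window box.**  For a box `N` with
`8·2ᵏ ≤ N ≤ 16·2ᵏ`, `N ≤ 8·2ʲ`, `k + m = j`, where `8·2ʲ` is the last window box and the exit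
estimate `u(8·2ʲ,β)⁻¹ ≤ u₀⁻¹ + κ₂⁺` holds, comparability and the dyadic law give
`u₀⁻¹ + κ₁ m - κ₃ - κ₂⁺ ≤ u(N,β)⁻¹ ≤ u₀⁻¹ + 2κ₂⁺ + κ₃ + κ₂⁺ m` (and `u₀⁻¹ ≤ u(N,β)⁻¹`). -/
theorem box_envelope (u : ℕ → ℝ → ℝ) (u₀ β₀ κ₁ κ₂ κ₃ κ₂p β : ℝ) (j N k m : ℕ)
    (hβ : β₀ ≤ β) (hκ₂p : κ₂ ≤ κ₂p)
    (hpos : ∀ (L : ℕ) (β : ℝ), 8 ≤ L → β₀ ≤ β → 0 < u L β)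
    (hcomp : ∀ (L L' : ℕ) (β : ℝ), β₀ ≤ β → 8 ≤ L → L ≤ L' → L' ≤ 2 * L →
        (∀ M : ℕ, 8 ≤ M → M ≤ L → u M β ≤ u₀) → |(u L β)⁻¹ - (u L' β)⁻¹| ≤ κ₂)
    (hdy : ∀ (k m : ℕ) (β : ℝ), β₀ ≤ β →
        (∀ M : ℕ, 8 ≤ M → M ≤ 8 * 2 ^ (k + m) → u M β ≤ u₀) →
        κ₁ * m - κ₃ ≤ (u (8 * 2 ^ k) β)⁻¹ - (u (8 * 2 ^ (k + m)) β)⁻¹ ∧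
          (u (8 * 2 ^ k) β)⁻¹ - (u (8 * 2 ^ (k + m)) β)⁻¹ ≤ κ₂ * m + κ₃)
    (hwin : ∀ M : ℕ, 8 ≤ M → M ≤ 8 * 2 ^ j → u M β ≤ u₀)
    (hexit : (u (8 * 2 ^ j) β)⁻¹ ≤ u₀⁻¹ + κ₂p)
    (hkN : 8 * 2 ^ k ≤ N) (hNk : N ≤ 16 * 2 ^ k) (hNj : N ≤ 8 * 2 ^ j) (hkm : k + m = j) :
    0 < u N β ∧ u₀⁻¹ ≤ (u N β)⁻¹ ∧ (u N β)⁻¹ ≤ u₀⁻¹ + 2 * κ₂p + κ₃ + κ₂p * m ∧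
      u₀⁻¹ + κ₁ * m - κ₃ - κ₂p ≤ (u N β)⁻¹ := by
  subst hkm
  have h8k : 8 ≤ 8 * 2 ^ k := by have := @Nat.one_le_two_pow k; omega
  have h8N : 8 ≤ N := le_trans h8k hkN
  have h8B : 8 ≤ 8 * 2 ^ (k + m) := by have := @Nat.one_le_two_pow (k + m); omega
  have hwink : ∀ M : ℕ, 8 ≤ M → M ≤ 8 * 2 ^ k → u M β ≤ u₀ :=
    fun M hM hMk => hwin M hM (hMk.trans (hkN.trans hNj))
  have hvpos : 0 < u N β := hpos N β h8N hβ
  have hx0 : u₀⁻¹ ≤ (u N β)⁻¹ := inv_anti₀ hvpos (hwin N h8N hNj)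
  have hBpos : 0 < u (8 * 2 ^ (k + m)) β := hpos _ β h8B hβ
  have hz0 : u₀⁻¹ ≤ (u (8 * 2 ^ (k + m)) β)⁻¹ := inv_anti₀ hBpos (hwin _ h8B le_rfl)
  have hc := hcomp (8 * 2 ^ k) N β hβ h8k hkN (by omega) hwink
  have hd := hdy k m β hβ hwin
  obtain ⟨hc1, hc2⟩ := abs_sub_le_iff.1 hc
  have hm0 : (0 : ℝ) ≤ m := Nat.cast_nonneg m
  have hκm : κ₂ * m ≤ κ₂p * m := mul_le_mul_of_nonneg_right hκ₂p hm0
  refine ⟨hvpos, hx0, ?_, ?_⟩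
  · linarith [hd.1, hd.2]
  · linarith [hd.1, hd.2]

/-- **E-b (IR-anchored telescoping).**  For a coupling with in-window comparability, the two-sided
averaged dyadic step law and per-datum axis matching, and a unit map pinned to the window exit,
the explicit shape `Γ s = (A₁ / (A₁ + κ₂⁺ · max 0 (log₂ (ℓ₀ / (8 s)))))²` and constants
`c' = c / A₁²`, `C' = max C 0 · R² / A₁²` satisfy the crux's two-sided axis clause and the pair
envelope on every box `L` with `L · a β ≤ ℓ₀`. -/
theorem stub_packageOfUnitMap :
    ∀ (u : ℕ → ℝ → ℝ) (u₀ β₀ κ₁ κ₂ κ₃ c C : ℝ) (a : ℝ → ℝ) (β₁ ℓ₀ D : ℝ) (A : ℕ → ℝ → ℕ → ℝ),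
      0 < u₀ → 0 < κ₁ → 0 ≤ κ₃ → 0 < c → 0 < ℓ₀ → β₀ ≤ β₁ → 0 ≤ D → (∀ β, 0 < a β) →
      (∀ (L : ℕ) (β : ℝ), 8 ≤ L → β₀ ≤ β → 0 < u L β) →
      (∀ (L L' : ℕ) (β : ℝ), β₀ ≤ β → 8 ≤ L → L ≤ L' → L' ≤ 2 * L →
          (∀ M : ℕ, 8 ≤ M → M ≤ L → u M β ≤ u₀) → |(u L β)⁻¹ - (u L' β)⁻¹| ≤ κ₂) →
      (∀ (k m : ℕ) (β : ℝ), β₀ ≤ β → (∀ M : ℕ, 8 ≤ M → M ≤ 8 * 2 ^ (k + m) → u M β ≤ u₀) →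
          κ₁ * m - κ₃ ≤ (u (8 * 2 ^ k) β)⁻¹ - (u (8 * 2 ^ (k + m)) β)⁻¹ ∧
            (u (8 * 2 ^ k) β)⁻¹ - (u (8 * 2 ^ (k + m)) β)⁻¹ ≤ κ₂ * m + κ₃) →
      (∀ (L : ℕ) (β : ℝ) (n : ℕ), β₀ ≤ β → 1 ≤ n → 8 * n ≤ L →
          (∀ M : ℕ, 8 ≤ M → M ≤ L → u M β ≤ u₀) →
          c * u (8 * n) β ^ 2 ≤ A L β n ∧ A L β n ≤ C * u (8 * n) β ^ 2) →
      (∀ β : ℝ, β₁ ≤ β → ∃ k₀ : ℕ, 1 ≤ k₀ ∧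
          (∀ M : ℕ, 8 ≤ M → M ≤ 8 * 2 ^ (k₀ - 1) → u M β ≤ u₀) ∧
          ¬ (∀ M : ℕ, 8 ≤ M → M ≤ 8 * 2 ^ k₀ → u M β ≤ u₀) ∧
          ℓ₀ / a β ≤ 8 * 2 ^ (k₀ - 1) ∧ (8 : ℝ) * 2 ^ k₀ ≤ 2 ^ D * (ℓ₀ / a β)) →
      ∃ (Γ : ℝ → ℝ) (c' C' : ℝ), 0 < c' ∧ (∀ s : ℝ, 0 < s → s ≤ ℓ₀ → 0 < Γ s ∧ Γ s ≤ 1) ∧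
        ∀ (L : ℕ) (β : ℝ), β₁ ≤ β → (L : ℝ) * a β ≤ ℓ₀ →
          (∀ M : ℕ, 8 ≤ M → M ≤ L → u M β ≤ u₀) ∧
          (∀ n : ℕ, 1 ≤ n → 8 * n ≤ L →
              c' * Γ ((n : ℝ) * a β) ≤ A L β n ∧ A L β n ≤ C' * Γ ((n : ℝ) * a β)) ∧
          (∀ d : ℝ, 1 ≤ d → d ≤ L →
              max C 0 * u (max 8 (min L (8 * ⌈d⌉₊))) β ^ 2 ≤ C' * Γ (d * a β)) := by
  intro u u₀ β₀ κ₁ κ₂ κ₃ c C a β₁ ℓ₀ D A hu₀ hκ₁ hκ₃ hc hℓ₀ hβ₁ hD ha hpos hcomp hdy hA hpin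
  -- the constants (only their defining inequalities are used below)
  obtain ⟨κ₂p, hκ₂p, hκ₂p0⟩ : ∃ κ₂p : ℝ, κ₂ ≤ κ₂p ∧ 0 ≤ κ₂p :=
    ⟨max κ₂ 0, le_max_left _ _, le_max_right _ _⟩
  have hi₀ : 0 < u₀⁻¹ := inv_pos.2 hu₀
  obtain ⟨A₁, hA₁, hA₁def⟩ : ∃ A₁ : ℝ, 0 < A₁ ∧ u₀⁻¹ + 2 * κ₂p + κ₃ + κ₂p * D ≤ A₁ :=
    ⟨u₀⁻¹ + 2 * κ₂p + κ₃ + κ₂p * D, by positivity, le_rfl⟩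
  have hS : 0 < κ₃ + κ₂p + κ₁ := by positivity
  obtain ⟨μ, hμ0, hμ1, hμS⟩ : ∃ μ : ℝ, 0 < μ ∧ μ ≤ 1 ∧ μ * (κ₃ + κ₂p + κ₁) ≤ u₀⁻¹ / 2 := by
    refine ⟨min 1 (u₀⁻¹ / (2 * (κ₃ + κ₂p + κ₁))), by positivity, min_le_left _ _, ?_⟩
    calc min 1 (u₀⁻¹ / (2 * (κ₃ + κ₂p + κ₁))) * (κ₃ + κ₂p + κ₁)
        ≤ u₀⁻¹ / (2 * (κ₃ + κ₂p + κ₁)) * (κ₃ + κ₂p + κ₁) :=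
          mul_le_mul_of_nonneg_right (min_le_right _ _) hS.le
      _ = u₀⁻¹ / 2 := by field_simp
  obtain ⟨R, hR0, hR1, hR2⟩ : ∃ R : ℝ, 0 ≤ R ∧ A₁ ≤ R * u₀⁻¹ / 2 ∧ κ₂p ≤ R * (μ * κ₁) := by
    refine ⟨max (2 * A₁ * u₀) (κ₂p / (μ * κ₁)), by positivity, ?_, ?_⟩
    · calc A₁ = 2 * A₁ * u₀ * u₀⁻¹ / 2 := by field_simp
        _ ≤ max (2 * A₁ * u₀) (κ₂p / (μ * κ₁)) * u₀⁻¹ / 2 := by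
          gcongr
          exact le_max_left _ _
    · calc κ₂p = κ₂p / (μ * κ₁) * (μ * κ₁) := by field_simp
        _ ≤ max (2 * A₁ * u₀) (κ₂p / (μ * κ₁)) * (μ * κ₁) :=
          mul_le_mul_of_nonneg_right (le_max_right _ _) (by positivity)
  -- the package
  refine ⟨fun s => (A₁ / (A₁ + κ₂p * max 0 (Real.logb 2 (ℓ₀ / (8 * s))))) ^ 2, c / A₁ ^ 2,
    max C 0 * R ^ 2 / A₁ ^ 2, by positivity, ?_, ?_⟩
  · intro s _ _
    have hT : 0 ≤ max 0 (Real.logb 2 (ℓ₀ / (8 * s))) := le_max_left _ _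
    have hP : A₁ ≤ A₁ + κ₂p * max 0 (Real.logb 2 (ℓ₀ / (8 * s))) := by nlinarith
    exact ⟨by positivity, pow_le_one₀ (by positivity) ((div_le_one (by positivity)).2 hP)⟩
  intro L β hβ hL
  have hβ₀ : β₀ ≤ β := hβ₁.trans hβ
  have haβ : 0 < a β := ha β
  obtain ⟨k₀, hk₀, hwin, hexit, pin₁, pin₂⟩ := hpin β hβ
  obtain ⟨j, rfl⟩ : ∃ j, k₀ = j + 1 := ⟨k₀ - 1, by omega⟩
  simp only [Nat.add_sub_cancel] at hwin pin₁
  have h8B : 8 ≤ 8 * 2 ^ j := by have := @Nat.one_le_two_pow j; omega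
  -- (W) the box `L` is in the window
  have hLQ : (L : ℝ) ≤ ℓ₀ / a β := by rwa [le_div_iff₀ haβ]
  have hLB : L ≤ 8 * 2 ^ j := by
    have : (L : ℝ) ≤ 8 * 2 ^ j := hLQ.trans pin₁
    exact_mod_cast this
  have hWL : ∀ M : ℕ, 8 ≤ M → M ≤ L → u M β ≤ u₀ := fun M hM hML => hwin M hM (hML.trans hLB)
  -- (X) the exit estimate
  have hz : (u (8 * 2 ^ j) β)⁻¹ ≤ u₀⁻¹ + κ₂p := by
    push Not at hexit
    obtain ⟨M', hM'8, hM'le, hM'u⟩ := hexit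
    have hBM' : 8 * 2 ^ j ≤ M' := by
      by_contra h
      push Not at h
      exact absurd (hwin M' hM'8 h.le) (not_le.2 hM'u)
    have hM'2 : M' ≤ 2 * (8 * 2 ^ j) := by rw [pow_succ] at hM'le; omega
    have hc' := hcomp (8 * 2 ^ j) M' β hβ₀ h8B hBM' hM'2 hwin
    have h1 : (u M' β)⁻¹ < u₀⁻¹ := inv_strictAnti₀ hu₀ hM'u
    linarith [(abs_sub_le_iff.1 hc').1]
  -- the envelope of a generic window box
  have box : ∀ N k m : ℕ, 8 * 2 ^ k ≤ N → N ≤ 16 * 2 ^ k → N ≤ 8 * 2 ^ j → k + m = j →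
      0 < u N β ∧ u₀⁻¹ ≤ (u N β)⁻¹ ∧ (u N β)⁻¹ ≤ u₀⁻¹ + 2 * κ₂p + κ₃ + κ₂p * m ∧
        u₀⁻¹ + κ₁ * m - κ₃ - κ₂p ≤ (u N β)⁻¹ :=
    fun N k m h1 h2 h3 h4 =>
      box_envelope u u₀ β₀ κ₁ κ₂ κ₃ κ₂p β j N k m hβ₀ hκ₂p hpos hcomp hdy hwin hz h1 h2 h3 h4
  refine ⟨hWL, ?_, ?_⟩
  · -- the axis clause
    intro n hn hnL
    obtain ⟨k, hk1, hk2⟩ := exists_dyadic_bracket (8 * n) (by omega)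
    have hkj : k ≤ j := (Nat.pow_le_pow_iff_right one_lt_two).1 (by omega)
    obtain ⟨m, hm⟩ := Nat.exists_eq_add_of_le hkj
    obtain ⟨hv, hx0, hxhi, hxlo⟩ := box (8 * n) k m hk1 (by omega) (by omega) hm.symm
    have hn' : (0 : ℝ) < n := by exact_mod_cast hn
    have h2k : (2 : ℝ) ^ k ≤ n := by exact_mod_cast (show 2 ^ k ≤ n by omega)
    have h2k1 : (n : ℝ) ≤ 2 ^ (k + 1) := by
      exact_mod_cast (show n ≤ 2 ^ (k + 1) by rw [pow_succ]; omega)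
    set T := max 0 (Real.logb 2 (ℓ₀ / (8 * ((n : ℝ) * a β)))) with hT_def
    have hT0 : 0 ≤ T := le_max_left _ _
    have hTm : T ≤ m := by
      refine max_logb_le ℓ₀ (a β) n j m hℓ₀ haβ hn' pin₁ ?_
      calc (8 : ℝ) * 2 ^ j = 2 ^ m * (8 * 2 ^ k) := by rw [hm]; ring
        _ ≤ 2 ^ m * (8 * n) := by gcongr
    have hmT : (m : ℝ) ≤ T + D := by
      refine le_max_logb_add ℓ₀ (a β) n D j m hℓ₀ haβ hn' pin₂ ?_
      calc (2 : ℝ) ^ m * (8 * n) ≤ 2 ^ m * (8 * 2 ^ (k + 1)) := by gcongr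
        _ = 8 * 2 ^ (j + 1) := by rw [hm]; ring
    have hPpos : 0 < A₁ + κ₂p * T := by positivity
    have hxP : (u (8 * n) β)⁻¹ ≤ A₁ + κ₂p * T := by
      linarith [mul_le_mul_of_nonneg_left hmT hκ₂p0]
    have hxlo' : u₀⁻¹ - (κ₃ + κ₂p + κ₁) + κ₁ * T ≤ (u (8 * n) β)⁻¹ := by
      linarith [mul_le_mul_of_nonneg_left hTm hκ₁.le]
    have hPR : A₁ + κ₂p * T ≤ R * (u (8 * n) β)⁻¹ :=
      envelope_ratio _ _ _ _ _ _ _ _ _ hx0 hxlo' hT0 hμ0.le hμ1 hμS hR0 hR1 hR2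
    obtain ⟨hA1, hA2⟩ := hA L β n hβ₀ hn hnL hWL
    constructor
    · calc c / A₁ ^ 2 * (A₁ / (A₁ + κ₂p * T)) ^ 2 ≤ c * u (8 * n) β ^ 2 :=
            sq_lower_of_inv_le _ _ _ _ hv hPpos hA₁ hc.le hxP
        _ ≤ A L β n := hA1
    · calc A L β n ≤ C * u (8 * n) β ^ 2 := hA2
        _ ≤ max C 0 * u (8 * n) β ^ 2 :=
            mul_le_mul_of_nonneg_right (le_max_left _ _) (sq_nonneg _)
        _ ≤ max C 0 * R ^ 2 / A₁ ^ 2 * (A₁ / (A₁ + κ₂p * T)) ^ 2 :=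
            sq_upper_of_le_inv _ _ _ _ _ hv hPpos hA₁ (le_max_right _ _) hPR
  · -- the pair envelope
    intro d hd1 hdL
    set L'' := max 8 (min L (8 * ⌈d⌉₊)) with hL''_def
    have hd0 : 0 < d := by linarith
    have hceil1 : 1 ≤ ⌈d⌉₊ := by
      have : (1 : ℝ) ≤ ⌈d⌉₊ := hd1.trans (Nat.le_ceil d)
      exact_mod_cast this
    have hL''8 : 8 ≤ L'' := le_max_left _ _
    have hL''B : L'' ≤ 8 * 2 ^ j := max_le h8B ((min_le_left _ _).trans hLB)
    have hL''d : L'' ≤ 8 * ⌈d⌉₊ := max_le (by omega) (min_le_right _ _)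
    obtain ⟨k, hk1, hk2⟩ := exists_dyadic_bracket L'' hL''8
    have hkj : k ≤ j := (Nat.pow_le_pow_iff_right one_lt_two).1 (by omega)
    obtain ⟨m, hm⟩ := Nat.exists_eq_add_of_le hkj
    obtain ⟨hv, hx0, -, hxlo⟩ := box L'' k m hk1 (by omega) hL''B hm.symm
    have hceil : (⌈d⌉₊ : ℝ) < d + 1 := Nat.ceil_lt_add_one hd0.le
    have h2k : (2 : ℝ) ^ k ≤ 2 * d := by
      have h' : (2 : ℝ) ^ k ≤ ⌈d⌉₊ := by exact_mod_cast (show 2 ^ k ≤ ⌈d⌉₊ by omega)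
      linarith
    set T := max 0 (Real.logb 2 (ℓ₀ / (8 * (d * a β)))) with hT_def
    have hT0 : 0 ≤ T := le_max_left _ _
    have hTm : T ≤ ((m + 1 : ℕ) : ℝ) := by
      refine max_logb_le ℓ₀ (a β) d j (m + 1) hℓ₀ haβ hd0 pin₁ ?_
      calc (8 : ℝ) * 2 ^ j = 2 ^ m * (4 * 2 ^ k) * 2 := by rw [hm]; ring
        _ ≤ 2 ^ m * (4 * (2 * d)) * 2 := by gcongr
        _ = 2 ^ (m + 1) * (8 * d) := by ring
    push_cast at hTm
    have hPpos : 0 < A₁ + κ₂p * T := by positivity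
    have hxlo' : u₀⁻¹ - (κ₃ + κ₂p + κ₁) + κ₁ * T ≤ (u L'' β)⁻¹ := by
      linarith [mul_le_mul_of_nonneg_left hTm hκ₁.le]
    have hPR : A₁ + κ₂p * T ≤ R * (u L'' β)⁻¹ :=
      envelope_ratio _ _ _ _ _ _ _ _ _ hx0 hxlo' hT0 hμ0.le hμ1 hμS hR0 hR1 hR2
    exact sq_upper_of_le_inv _ _ _ _ _ hv hPpos hA₁ (le_max_right _ _) hPR

end Summit.QuantumFields.YangMills.Theorems.FemtoCurvatureTwoPointC
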